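import Mathlib.Data.ZMod.Basic
import HarnessLib

/-!
# Asymmetric aperiodic CM halves of `ℤ/2n` (`n ≥ 6`)

COR-CM (cell `pub-hodgecm2`), binder seat b04 (gen 22), count-neutral claim GALOIS-DIHEDRAL, part II — the
combinatorial input of the MIRROR TYPES of part I (`CorCM/GaloisDihedralMirrorTypes`).  KERNEL ONLY: theorems; no
definition, no named fact, no `sorry`.  Mathlib only.  `HC_CM` is neither used nor claimed.

A CM HALF of `ℤ/2n` is a subset `S` with `k ∈ S ⟺ k + n ∉ S` (one element of each pair `{k, k + n}`; these are the
CM types of the cyclic subgroup `⟨r⟩ ≅ ℤ/2n` of the dihedral group of order `4n` read on the exponents, complex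
conjugation `= rⁿ`).  It is APERIODIC if no translate `j + S`, `j ≠ 0`, equals `S`, and ASYMMETRIC if no reflection
`u − S` equals `S`.  The mirror type `r(S) ⊔ {s rᵐ : t − m ∈ S}` of part I has trivial left stabiliser in the dihedral
group exactly when `S` is aperiodic and asymmetric (part I §3).  Seat census (`scratch/g22b.py`): the numbers of
aperiodic asymmetric CM halves of `ℤ/2n` for `n = 2, …, 10` are `0, 0, 0, 0, 24, 28, 128, 252, 720` — they exist iff
`n ≥ 6`.  This file gives the explicit family
`S(n) = {0, 1, 3, 4, …, n − 1} ∪ {n + 2} = {k : (k < n ∧ k ≠ 2) ∨ k = n + 2}` (residues read in `[0, 2n)`; the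
interval `[0, n)` with the point `2` replaced by its antipode `n + 2`) and proves, for `n ≥ 6`:

* §1 `val` bookkeeping in `ZMod N` (`val_add_natCast_eq`, `val_natCast_sub_eq`);
* §2 `exists_half` (the set exists), `half_mem_add_iff` (CM half: `k ∈ S ↔ k + n ∉ S`, `n ≥ 3`);
* §3 `half_aperiodic` (`j ≠ 0 ⟹ ∃ k, ¬(k ∈ S ↔ j + k ∈ S)`: from `1 ∈ S` twice, `(j+1) + (1−j) = 2` has no solution
  in `S × S` other than `1 + 1`), `half_asymmetric` (`∀ u, ∃ k, ¬(k ∈ S ↔ u − k ∈ S)`: the memberships of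
  `u − 1, u − 2, u − 3, u − 5` force `u = 4` and then `u − 5 = −1 ∉ S`; uses `5 ∈ S`, i.e. `n ≥ 6`).

All proofs: membership is a statement about `k.val ∈ [0, 2n)`, and `omega` closes the residue arithmetic.

## References

* [Shimura1998] G. Shimura, *Abelian Varieties with Complex Multiplication and Modular Functions*, §8.2 Prop. 26
  (left stabiliser of a CM type).
* [Dodson1984] B. Dodson, *The structure of Galois groups of CM-fields*, Trans. AMS 283 (1984), §3.3.1 (C).

Provenance: Literature home (family `hodge`, namespace `Literature.NumberTheory.ComplexMultiplication.CyclicAsymmetricHalves`) of the Summits-side `CorCM/CyclicAsymmetricCMHalves` (cell `pub-hodgecm2`, COR-CM; all its imports are `Literature/` and Mathlib), which `Literature/` may not import; theorems only, no named fact, no definition. Nothing here bears on `HC_CM`. Lane `lit-hodgefound` (Layer A3: CM types, their Kubota ranks and Galois combinatorics), seat p20.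
-/

namespace Literature.NumberTheory.ComplexMultiplication.CyclicAsymmetricHalves

/-! ## §1 `val` bookkeeping in `ZMod N` -/

section Val

variable {N : ℕ} [NeZero N]

/-- `(x + c).val` for a natural number `c < N`. [cite: Shimura1998, §8.2 Prop. 26] -/
theorem val_add_natCast_eq (x : ZMod N) {c : ℕ} (hc : c < N) :
    (x + (c : ZMod N)).val = if x.val + c < N then x.val + c else x.val + c - N := by
  rw [ZMod.val_add, ZMod.val_natCast, Nat.mod_eq_of_lt hc]
  split_ifs with h
  · exact Nat.mod_eq_of_lt h
  · have hx := x.val_lt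
    rw [Nat.mod_eq_sub_mod (by omega), Nat.mod_eq_of_lt (by omega)]

/-- `(c - x).val` for a natural number `c < N`. [cite: Shimura1998, §8.2 Prop. 26] -/
theorem val_natCast_sub_eq (x : ZMod N) {c : ℕ} (hc : c < N) :
    ((c : ZMod N) - x).val = if x.val ≤ c then c - x.val else c + N - x.val := by
  have hx := x.val_lt
  by_cases hx0 : x = 0
  · subst hx0
    simp only [sub_zero, ZMod.val_zero, Nat.zero_le, if_true, Nat.sub_zero]
    rw [ZMod.val_natCast, Nat.mod_eq_of_lt hc]
  · rw [sub_eq_add_neg, ZMod.val_add, ZMod.val_natCast, Nat.mod_eq_of_lt hc, ZMod.neg_val, if_neg hx0]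
    split_ifs with h
    · rw [show c + (N - x.val) = N + (c - x.val) by omega, Nat.add_mod_left, Nat.mod_eq_of_lt (by omega)]
    · rw [Nat.mod_eq_of_lt (by omega)]
      omega

/-- `(x - c).val` for a natural number `c < N`. [cite: Shimura1998, §8.2 Prop. 26] -/
theorem val_sub_natCast_eq (x : ZMod N) {c : ℕ} (hc : c < N) :
    (x - (c : ZMod N)).val = if c ≤ x.val then x.val - c else x.val + N - c := by
  have hx := x.val_lt
  rcases Nat.eq_zero_or_pos c with rfl | hc0
  · simp
  · have hcast : (x - (c : ZMod N)) = x + ((N - c : ℕ) : ZMod N) := by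
      rw [Nat.cast_sub hc.le, ZMod.natCast_self, zero_sub, sub_eq_add_neg]
    rw [hcast, val_add_natCast_eq x (show N - c < N by omega)]
    split_ifs <;> omega

omit [NeZero N] in
/-- `(c : ZMod N).val = c` for `c < N`. [cite: Shimura1998, §8.2 Prop. 26] -/
theorem val_natCast_of_lt' {c : ℕ} (hc : c < N) : ((c : ZMod N)).val = c := by
  rw [ZMod.val_natCast, Nat.mod_eq_of_lt hc]

end Val

/-! ## §2 The explicit half and its CM property -/

section Half

variable {n : ℕ} [NeZero n] {S : Finset (ZMod (2 * n))}

/-- **The explicit half exists** as a finite subset of `ℤ/2n`: `k ∈ S ↔ (k.val < n ∧ k.val ≠ 2) ∨ k.val = n + 2`.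
 [cite: Shimura1998, §8.2 Prop. 26] -/
theorem exists_half (n : ℕ) [NeZero n] :
    ∃ S : Finset (ZMod (2 * n)), ∀ k : ZMod (2 * n), k ∈ S ↔ (k.val < n ∧ k.val ≠ 2) ∨ k.val = n + 2 :=
  ⟨Finset.univ.filter fun k => (k.val < n ∧ k.val ≠ 2) ∨ k.val = n + 2, fun k => by simp⟩

omit [NeZero n] in
/-- Membership of a natural number `c < 2n` (e.g. `0, 1, 3, 5 ∈ S`, `2 ∉ S` for `n ≥ 6`). [cite: Shimura1998, §8.2 Prop. 26] -/
theorem natCast_mem_half_iff (hS : ∀ k : ZMod (2 * n), k ∈ S ↔ (k.val < n ∧ k.val ≠ 2) ∨ k.val = n + 2)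
    {c : ℕ} (hc : c < 2 * n) : (c : ZMod (2 * n)) ∈ S ↔ (c < n ∧ c ≠ 2) ∨ c = n + 2 := by
  rw [hS, val_natCast_of_lt' hc]

/-- **`S` is a CM half: `k ∈ S ↔ k + n ∉ S`** (`n ≥ 3`, so that `n + 2 < 2n`). [cite: Shimura1998, §8.2 Prop. 26] -/
theorem half_mem_iff_add_not_mem (h3 : 3 ≤ n)
    (hS : ∀ k : ZMod (2 * n), k ∈ S ↔ (k.val < n ∧ k.val ≠ 2) ∨ k.val = n + 2) (k : ZMod (2 * n)) :
    k ∈ S ↔ k + (n : ZMod (2 * n)) ∉ S := by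
  have hk := k.val_lt
  rw [hS, hS, val_add_natCast_eq k (show n < 2 * n by omega)]
  split_ifs with h <;> omega

/-- The same with the summands commuted: `k ∈ S ↔ n + k ∉ S`. [cite: Shimura1998, §8.2 Prop. 26] -/
theorem half_mem_iff_nat_add_not_mem (h3 : 3 ≤ n)
    (hS : ∀ k : ZMod (2 * n), k ∈ S ↔ (k.val < n ∧ k.val ≠ 2) ∨ k.val = n + 2) (k : ZMod (2 * n)) :
    k ∈ S ↔ (n : ZMod (2 * n)) + k ∉ S := by
  rw [add_comm]; exact half_mem_iff_add_not_mem h3 hS k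

/-- `S` is nonempty: `0 ∈ S`. [cite: Shimura1998, §8.2 Prop. 26] -/
theorem zero_mem_half (hS : ∀ k : ZMod (2 * n), k ∈ S ↔ (k.val < n ∧ k.val ≠ 2) ∨ k.val = n + 2) :
    (0 : ZMod (2 * n)) ∈ S := by
  rw [hS, ZMod.val_zero]
  have := NeZero.ne n
  omega

/-! ## §3 Aperiodic and asymmetric (`n ≥ 6`) -/

/-- **`S` is APERIODIC**: no translate `j + S` with `j ≠ 0` equals `S`.  (If `k ∈ S ↔ j + k ∈ S` for all `k`, then
`k = 1` and `k = 1 - j` put `j + 1` and `1 - j` in `S`; two elements of `S` with sum `2` are both `1`, so `j = 0`.)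
[cite: Shimura1998, §8.2 Prop. 26] -/
theorem half_aperiodic (h6 : 6 ≤ n)
    (hS : ∀ k : ZMod (2 * n), k ∈ S ↔ (k.val < n ∧ k.val ≠ 2) ∨ k.val = n + 2) {j : ZMod (2 * n)} (hj : j ≠ 0) :
    ∃ k : ZMod (2 * n), ¬ (k ∈ S ↔ j + k ∈ S) := by
  by_contra hall
  push Not at hall
  have hb := j.val_lt
  have hb0 : j.val ≠ 0 := fun h => hj ((ZMod.val_eq_zero j).1 h)
  have h1 : ((1 : ℕ) : ZMod (2 * n)) ∈ S := (natCast_mem_half_iff hS (by omega)).2 (Or.inl ⟨by omega, by omega⟩)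
  -- `j + 1 ∈ S`
  have hA := (hall ((1 : ℕ) : ZMod (2 * n))).1 h1
  rw [hS, val_add_natCast_eq j (show 1 < 2 * n by omega)] at hA
  -- `1 - j ∈ S`
  have hB := (hall (((1 : ℕ) : ZMod (2 * n)) - j)).2 (by rwa [add_sub_cancel])
  rw [hS, val_natCast_sub_eq j (show 1 < 2 * n by omega)] at hB
  split_ifs at hA hB <;> omega

/-- **`S` is ASYMMETRIC**: no reflection `u - S` equals `S`.  (The memberships of `u - 1`, `u - 3`, `u - 5 ∈ S` and
`u - 2 ∉ S` are contradictory: the first three with the last force `u = 4`, and `4 - 5 = -1 ∉ S`; here `5 ∈ S` needs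
`n ≥ 6` — for `n ≤ 5` every CM half of `ℤ/2n` IS symmetric.) [cite: Shimura1998, §8.2 Prop. 26] -/
theorem half_asymmetric (h6 : 6 ≤ n)
    (hS : ∀ k : ZMod (2 * n), k ∈ S ↔ (k.val < n ∧ k.val ≠ 2) ∨ k.val = n + 2) (u : ZMod (2 * n)) :
    ∃ k : ZMod (2 * n), ¬ (k ∈ S ↔ u - k ∈ S) := by
  by_contra hall
  push Not at hall
  have ha := u.val_lt
  have h1 : ((1 : ℕ) : ZMod (2 * n)) ∈ S := (natCast_mem_half_iff hS (by omega)).2 (Or.inl ⟨by omega, by omega⟩)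
  have h3 : ((3 : ℕ) : ZMod (2 * n)) ∈ S := (natCast_mem_half_iff hS (by omega)).2 (Or.inl ⟨by omega, by omega⟩)
  have h5 : ((5 : ℕ) : ZMod (2 * n)) ∈ S := (natCast_mem_half_iff hS (by omega)).2 (Or.inl ⟨by omega, by omega⟩)
  have h2 : ((2 : ℕ) : ZMod (2 * n)) ∉ S := fun h =>
    by have := (natCast_mem_half_iff hS (show 2 < 2 * n by omega)).1 h; omega
  have hA := (hall ((1 : ℕ) : ZMod (2 * n))).1 h1
  have hB := (hall ((3 : ℕ) : ZMod (2 * n))).1 h3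
  have hC := (hall ((5 : ℕ) : ZMod (2 * n))).1 h5
  have hD : u - ((2 : ℕ) : ZMod (2 * n)) ∉ S := fun h => h2 ((hall _).2 h)
  rw [hS, val_sub_natCast_eq u (show 1 < 2 * n by omega)] at hA
  rw [hS, val_sub_natCast_eq u (show 3 < 2 * n by omega)] at hB
  rw [hS, val_sub_natCast_eq u (show 5 < 2 * n by omega)] at hC
  rw [hS, val_sub_natCast_eq u (show 2 < 2 * n by omega)] at hD
  split_ifs at hA hB hC hD <;> omega

end Half

end Literature.NumberTheory.ComplexMultiplication.CyclicAsymmetricHalves
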